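import Summits.QuantumFields.BalabanUV.T4Continuum.Support.NE9Lemma1CurveSpecies
import Summits.QuantumFields.BalabanUV.T4Continuum.Support.NE9Lemma1RemainderSpeciesAdditive

/-!
# NE9Lemma1CurveSpeciesAdditive — crew row (w19): S3 for the CURVE species on the analytic class — the (1.23)-functional of
# the Taylor remainder ALONG AN ANALYTIC CURVE (`NE9Lemma1CurveRemainder.curPiece`) is additive in the old term under joint
# continuity of the slice-curve family, whence `PieceAdditiveOn (analyticClass D.R) D.toC` for the owner's `CurData` species
# and the four S-binders of the NE9 END at once (cell `pub-balaban`, T4-DAG §2 node U3 / §6 NE9; unit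
# b2b-balaban-t4-ne9-formalise-leaf-08 gen 4; twin of this unit's (w16) `NE9Lemma1RemainderSpeciesAdditive` after the row
# OWNER's LOCATED FINDING F-ne9p1g25-1: the ray datum is the abelian sub-case, the σ-disc of [I] (3.53)–(3.54) is a CURVE)

HONEST FRAMING (T4-DAG PAGE 1).  Rung (B)+1 of the FINITE-VOLUME T⁴ programme — existence and uniqueness of the ε → 0 limit
of gauge-invariant observables on a FIXED finite torus; NOT infinite volume, NOT a mass gap, NOT the Clay problem.  NE9
(`T4OutputRate.NE9` ∧ `FadingMemory`) is a cell NEW ESTIMATE, NOT PRINTED, NOT discharged here («NE9 ⇐ the named binders»);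
spine 0/9; 0/18 skeleton leaves instantiated on Bałaban's objects — the species is the owner's FORM-level `CurData.toC`, whose
identification with Bałaban's (1.23)/(1.33) pieces is O-NE9-1 (NODE O), NOT claimed.  HONEST DEPENDENCY (cell line, verbatim):
continuum YM on T⁴ ⇐ BetaPertH ∧ nine spine estimates (0/9 proved); BetaPertH ⇐ (D1) ∧ (D4) ∧ CAP+tail; G-an2-4 gates asym, D1
and NE2/3/4.  `FlowStep.BetaPertH`, (B), (B^μ) do not occur.  [I] = [Balaban1987RG1] (CMP **109**), [II] = [Balaban1988RG2Cluster]
(CMP **116**) are quoted for TYPES only (ABSOLUTE RULE: nothing printed in the audited series is asserted).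

WHERE THIS SITS.  The owner's curve species (`NE9Lemma1CurveRemainder` p213669, `NE9Lemma1CurveSpecies`): `curRem H n γ :=
taylorRem (σ ↦ H (γ σ)) n 1`, `curPiece ρ r l H n Γ s σ := (2πi)⁻¹∮_{|t|=r} t⁻² • cauchyOp ρ l (curRem H n (Γ t · ·)) s σ`, the
datum `CurData` (slice curves `cur`, slice radii `ϱ`), with `PieceZero`/`PieceLocal`/`PieceBoundOnG` (S5) PROVED on the analytic
class and `PieceAdditiveOn` recorded as the implication `channelAdditive_cur_of_pieceAdditive` — crew row (w19).  THIS FILE: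
* §1 `taylorRem_comp_sub`/`_add` — the Taylor remainder of a COMPOSITE slice `H ∘ γ` is subtractive in `H` for `H₁, H₂` analytic
  on the ball and `γ` analytic on a disc into it (leaf-03's `taylorRem_sub` BY NAME; analyticity load-bearing);
* §2 **`continuous_taylorRem_comp`** — for `H` analytic on `‖z‖ < R`, `ϱ > 1` and a curve FAMILY `γ : P → ℂ → E` with each
  `γ p` analytic on `|σ| < ϱ` into that ball and `(p, z) ↦ γ p z` jointly continuous on the UNIT CIRCLE of the slice variable,
  `p ↦ taylorRem (H ∘ γ p) n 1` is continuous: the Newton–Taylor coefficients are Cauchy integrals over `|z| = 1 < ϱ`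
  (leaf-03's `tail_eq_circleIntegral`), continuous in `p` by Mathlib's `intervalIntegral.continuous_parametric_intervalIntegral_
  of_continuous'` — LOCAL continuity of `H` on its ball suffices, no sup bound;
* §3 `curRem_sub`/`_add`, `continuous_curRem_family`, **`curPiece_sub`** — the (1.23)-functional of the curve remainder is
  subtractive in the old term, by this unit's engine `NE9RemainderPieceAdditive.cauchyOp_sub`/`continuous_cauchyOp` with the
  remainder family's continuity DERIVED from §2 (no remainder-level binder displayed);
* §4 **`pieceAdditiveOn_cur`** — `PieceAdditiveOn (analyticClass D.R) D.toC` for `D : CurData …` under `κ₁ > 0`, `r_k > 0`,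
  `ϱ > 1` and the SLICE-CURVE REGULARITY binders (displayed, instantiation-side; TYPE [I] Lemma 4 (3.53) p. 280 *"(U_j(□₀,
  exp i(τB + B′)), J_j(□₀, exp i(τB + B′)))|_X ∈ U^c_j(X, α₀, α₁)"* and [II] (1.21)/(1.23) p. 7): `hcurA` (every slice curve
  analytic on its disc into the analyticity ball — `Admissible.cur_an` asked everywhere, a harmless convention off the
  contours) and `hcurC` (joint continuity of `(t, s, σ, σ′) ↦ cur … t s σ σ′` on the unit slice circle); `channelAdditive_cur`
  (S3) and `sBinders_cur` (S3 ∧ S4 ∧ S5, the latter the owner's BY NAME).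
DISGUISE TEST: one curve family of one term pair; additivity of a linear functional — no history comparison, not NE9.

References (TYPES only): [Balaban1987RG1] T. Bałaban, CMP **109** (1987) 249–301, (3.53)–(3.54) p. 280; [Balaban1988RG2Cluster]
T. Bałaban, CMP **116** (1988) 1–22, (1.21)–(1.25) p. 7 (render `b2b-balaban-ref1/pages/1988-cmp116-rg-II-cluster/…-p007-x2.png`
re-read as image by this seat, 2026-08-20).  Summits-side NEW work (LEAN PLACEMENT RULE); imports `NE9Lemma1CurveSpecies`
(owner), `NE9Lemma1RemainderSpeciesAdditive` (this unit; hence `NE9RemainderPieceAdditive`, `NE9RemainderPieceLinear`) BY NAME;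
modifies nothing; 0 def; 0 sorry; `[folklore]`.  Value = S3 for the curve species at FORM level modulo displayed curve
regularity, NOT summit progress.
-/

noncomputable section

namespace Summit.QuantumFields.BalabanUV.T4Continuum.NE9Lemma1CurveSpeciesAdditive

open scoped BigOperators
open Metric Set Complex MeasureTheory
open Literature.MathematicalPhysics.QuantumFieldTheory.Balaban1983to89
open Literature.MathematicalPhysics.QuantumFieldTheory.Balaban1983to89.B11SchwarzRemainder (tail)
open Literature.MathematicalPhysics.QuantumFieldTheory.Balaban1983to89.B13Sect1Arith (cauchyOp)
open Summit.QuantumFields.BalabanUV.T4Continuum.NE9Lemma1RemainderPiece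
open Summit.QuantumFields.BalabanUV.T4Continuum.NE9RemainderPieceCoupling (taylorRem_sub)
open Summit.QuantumFields.BalabanUV.T4Continuum.NE9RemainderPieceLinear (tail_eq_circleIntegral)
open Summit.QuantumFields.BalabanUV.T4Continuum.NE9RemainderPieceAdditive (continuous_cauchyOp cauchyOp_sub cauchyOp_add)
open Summit.QuantumFields.BalabanUV.T4Continuum.NE9Lemma1CurveRemainder
open Summit.QuantumFields.BalabanUV.T4Continuum.NE9Lemma1PieceClass
open Summit.QuantumFields.BalabanUV.T4Continuum.NE9Lemma1RemainderSpecies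
open Summit.QuantumFields.BalabanUV.T4Continuum.NE9Lemma1RemainderSpeciesAdditive (reIm_sub one_lt_exp_of_pos)
open Summit.QuantumFields.BalabanUV.T4Continuum.NE9Lemma1CurveSpecies
open Summit.QuantumFields.BalabanUV.T4Continuum.NE9ComplexEncoding (doubleCarriers)
open Literature.MathematicalPhysics.QuantumFieldTheory.Balaban1983to89.T4OutputRate
open Literature.MathematicalPhysics.QuantumFieldTheory.Balaban1983to89.T4HistoryLipschitzRecursion
open Summit.QuantumFields.BalabanUV.T4Continuum.NE9Lemma1Counting
open Summit.QuantumFields.BalabanUV.T4Continuum.NE9Lemma1Gain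

variable {E : Type*} [NormedAddCommGroup E] [NormedSpace ℂ E] {F : Type*} [NormedAddCommGroup F] [NormedSpace ℂ F]
  [CompleteSpace F]

/-! ## §1 The Taylor remainder of a composite slice is subtractive in the outer (old-term) function -/

/-- **THE CURVE REMAINDER IS SUBTRACTIVE IN THE OLD TERM** on the analytic class: for `H₁, H₂` analytic on the ball
`‖z‖ < R` and a curve `γ` analytic on the disc `|τ| < ϱ` (ϱ > 0) with values in that ball,
`taylorRem ((H₁ − H₂) ∘ γ) n t = taylorRem (H₁ ∘ γ) n t − taylorRem (H₂ ∘ γ) n t` (leaf-03's `taylorRem_sub` on the composite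
slices; the analyticity is load-bearing — the divided-slope tails take derivatives at 0). [folklore] -/
theorem taylorRem_comp_sub {H₁ H₂ : E → F} {R ϱ : ℝ} (hϱ : 0 < ϱ) (hH₁ : DifferentiableOn ℂ H₁ (ball 0 R))
    (hH₂ : DifferentiableOn ℂ H₂ (ball 0 R)) {γ : ℂ → E} (hγ : DifferentiableOn ℂ γ (ball 0 ϱ))
    (hγR : MapsTo γ (ball 0 ϱ) (ball 0 R)) (n : ℕ) (t : ℂ) :
    taylorRem ((H₁ - H₂) ∘ γ) n t = taylorRem (H₁ ∘ γ) n t - taylorRem (H₂ ∘ γ) n t := by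
  have hfun : (H₁ - H₂) ∘ γ = H₁ ∘ γ - H₂ ∘ γ := rfl
  rw [hfun]
  exact taylorRem_sub hϱ (differentiableOn_curSlice hH₁ hγ hγR) (differentiableOn_curSlice hH₂ hγ hγR) n t

/-- Additive form. [folklore] -/
theorem taylorRem_comp_add {H₁ H₂ : E → F} {R ϱ : ℝ} (hϱ : 0 < ϱ) (hH₁ : DifferentiableOn ℂ H₁ (ball 0 R))
    (hH₂ : DifferentiableOn ℂ H₂ (ball 0 R)) {γ : ℂ → E} (hγ : DifferentiableOn ℂ γ (ball 0 ϱ))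
    (hγR : MapsTo γ (ball 0 ϱ) (ball 0 R)) (n : ℕ) (t : ℂ) :
    taylorRem ((H₁ + H₂) ∘ γ) n t = taylorRem (H₁ ∘ γ) n t + taylorRem (H₂ ∘ γ) n t := by
  have h := taylorRem_comp_sub hϱ (hH₁.add hH₂) hH₂ hγ hγR n t
  rw [add_sub_cancel_right] at h
  rw [h, sub_add_cancel]

/-! ## §2 The Taylor remainder of the composite slice is CONTINUOUS in the curve, for a jointly continuous curve family -/

omit [CompleteSpace F] in
/-- A Cauchy coefficient integral over the unit circle is continuous in the curve parameter: for `H` analytic on the ball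
`‖z‖ < R` and a curve family `γ p` whose unit-circle values lie in that ball and depend jointly continuously on `(p, z)`
there, `p ↦ ∮_{|z|=1} z^{−(m+1)} • H(γ p z) dz` is continuous (parametric interval integral; the integrand is jointly
continuous because `H` is continuous where the curves take it — no sup bound on `H`). [folklore] -/
theorem continuous_circleIntegral_comp {P : Type*} [TopologicalSpace P] {H : E → F} {R : ℝ}
    (hH : DifferentiableOn ℂ H (ball 0 R)) {γ : P → ℂ → E}
    (hγc : ContinuousOn (fun q : P × ℂ => γ q.1 q.2) (univ ×ˢ sphere (0:ℂ) 1))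
    (hγR : ∀ p, ∀ z ∈ sphere (0:ℂ) 1, γ p z ∈ ball (0:E) R) (m : ℕ) :
    Continuous fun p => ∮ z in C(0, 1), (z ^ (m + 1))⁻¹ • H (γ p z) := by
  have hcm : ∀ θ : ℝ, circleMap 0 1 θ ∈ sphere (0:ℂ) 1 := fun θ => circleMap_mem_sphere 0 zero_le_one θ
  -- (p, θ) ↦ γ p (circleMap 0 1 θ) is continuous, with values in the ball
  have hγθ : Continuous fun w : P × ℝ => γ w.1 (circleMap 0 1 w.2) := by
    have hm : Continuous fun w : P × ℝ => (w.1, circleMap 0 1 w.2) :=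
      continuous_fst.prodMk ((continuous_circleMap 0 1).comp continuous_snd)
    exact hγc.comp_continuous hm fun w => ⟨mem_univ _, hcm w.2⟩
  have hHγ : Continuous fun w : P × ℝ => H (γ w.1 (circleMap 0 1 w.2)) :=
    hH.continuousOn.comp_continuous hγθ fun w => hγR w.1 _ (hcm w.2)
  have hpow : Continuous fun w : P × ℝ => ((circleMap 0 1 w.2) ^ (m + 1))⁻¹ := by
    refine Continuous.inv₀ (((continuous_circleMap 0 1).comp continuous_snd).pow (m + 1)) fun w => pow_ne_zero _ ?_
    exact fun h0 => by simpa [h0] using hcm w.2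
  have hd : Continuous fun w : P × ℝ => deriv (circleMap 0 1) w.2 := by
    simp_rw [deriv_circleMap]
    exact ((continuous_circleMap 0 1).comp continuous_snd).mul continuous_const
  have hΨ : Continuous (Function.uncurry fun (p : P) (θ : ℝ) => deriv (circleMap 0 1) θ •
      (((circleMap 0 1 θ) ^ (m + 1))⁻¹ • H (γ p (circleMap 0 1 θ)))) :=
    hd.smul (hpow.smul hHγ)
  have h := intervalIntegral.continuous_parametric_intervalIntegral_of_continuous' (μ := volume) hΨ 0 (2 * Real.pi)
  simp only [circleIntegral]
  exact h

/-- **THE COMPOSITE-SLICE REMAINDER IS CONTINUOUS IN THE CURVE**: for `H` analytic on `‖z‖ < R`, `ϱ > 1`, and a curve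
family `γ : P → ℂ → E` with every `γ p` analytic on `|τ| < ϱ` into that ball and `(p, z) ↦ γ p z` jointly continuous on
the unit circle of the slice variable, `p ↦ taylorRem (H ∘ γ p) n 1` is continuous — the Newton–Taylor coefficients of
the composite slice are the Cauchy integrals of `continuous_circleIntegral_comp` (leaf-03's `tail_eq_circleIntegral` at
`r₁ = 1 < ϱ`), and the value term is `H (γ p 1)`.  This DERIVES the «continuity of the composite slices» that the additivity
of the curve piece needs, from joint continuity of the curve family alone. [folklore] -/
theorem continuous_taylorRem_comp {P : Type*} [TopologicalSpace P] {H : E → F} {R ϱ : ℝ} (hϱ : 1 < ϱ)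
    (hH : DifferentiableOn ℂ H (ball 0 R)) {γ : P → ℂ → E} (hγ : ∀ p, DifferentiableOn ℂ (γ p) (ball 0 ϱ))
    (hγR : ∀ p, MapsTo (γ p) (ball 0 ϱ) (ball 0 R))
    (hγc : ContinuousOn (fun q : P × ℂ => γ q.1 q.2) (univ ×ˢ sphere (0:ℂ) 1)) (n : ℕ) :
    Continuous fun p => taylorRem (H ∘ γ p) n 1 := by
  have hsph : sphere (0:ℂ) 1 ⊆ ball (0:ℂ) ϱ := fun z hz => by
    rw [mem_ball_zero_iff]; rw [mem_sphere_zero_iff_norm] at hz; rw [hz]; exact hϱ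
  have h1 : (1:ℂ) ∈ sphere (0:ℂ) 1 := by simp
  have hγR' : ∀ p, ∀ z ∈ sphere (0:ℂ) 1, γ p z ∈ ball (0:E) R := fun p z hz => hγR p (hsph hz)
  -- the closed form on the unit circle
  have hform : ∀ p, taylorRem (H ∘ γ p) n 1 =
      H (γ p 1) - ∑ m ∈ Finset.range n, (2 * Real.pi * I : ℂ)⁻¹ • ∮ z in C(0, 1), (z ^ (m + 1))⁻¹ • H (γ p z) := by
    intro p
    have hd : DifferentiableOn ℂ (H ∘ γ p) (ball 0 ϱ) := differentiableOn_curSlice hH (hγ p) (hγR p)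
    simp only [taylorRem, taylorHead, one_pow, one_smul, Function.comp_apply]
    congr 1
    refine Finset.sum_congr rfl fun m _ => ?_
    rw [tail_eq_circleIntegral one_pos hϱ m _ hd]
    rfl
  -- continuity of the value term and of each coefficient
  have hval : Continuous fun p => H (γ p 1) := by
    have hγ1 : Continuous fun p : P => γ p 1 :=
      hγc.comp_continuous (continuous_id.prodMk continuous_const) fun p => ⟨mem_univ _, h1⟩
    exact hH.continuousOn.comp_continuous hγ1 fun p => hγR' p 1 h1
  have hsum : Continuous fun p => ∑ m ∈ Finset.range n,
      (2 * Real.pi * I : ℂ)⁻¹ • ∮ z in C(0, 1), (z ^ (m + 1))⁻¹ • H (γ p z) :=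
    continuous_finsetSum _ fun m _ => (continuous_circleIntegral_comp hH hγc hγR' m).const_smul _
  have h := hval.sub hsum
  exact h.congr fun p => (hform p).symm

/-- Convenience form with a GLOBALLY jointly continuous curve family. [folklore] -/
theorem continuous_taylorRem_comp' {P : Type*} [TopologicalSpace P] {H : E → F} {R ϱ : ℝ} (hϱ : 1 < ϱ)
    (hH : DifferentiableOn ℂ H (ball 0 R)) {γ : P → ℂ → E} (hγ : ∀ p, DifferentiableOn ℂ (γ p) (ball 0 ϱ))
    (hγR : ∀ p, MapsTo (γ p) (ball 0 ϱ) (ball 0 R)) (hγc : Continuous fun q : P × ℂ => γ q.1 q.2) (n : ℕ) :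
    Continuous fun p => taylorRem (H ∘ γ p) n 1 :=
  continuous_taylorRem_comp hϱ hH hγ hγR hγc.continuousOn n


/-! ## §3 The curve remainder and its (1.23)-functional are additive in the old term -/

/-- **`curRem` IS SUBTRACTIVE IN THE OLD TERM** on the analytic class (`curRem H n γ = taylorRem (H ∘ γ) n 1`). [folklore] -/
theorem curRem_sub {H₁ H₂ : E → F} {R ϱ : ℝ} (hϱ : 0 < ϱ) (hH₁ : DifferentiableOn ℂ H₁ (ball 0 R))
    (hH₂ : DifferentiableOn ℂ H₂ (ball 0 R)) (n : ℕ) {γ : ℂ → E} (hγ : DifferentiableOn ℂ γ (ball 0 ϱ))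
    (hγR : MapsTo γ (ball 0 ϱ) (ball 0 R)) : curRem (H₁ - H₂) n γ = curRem H₁ n γ - curRem H₂ n γ :=
  taylorRem_comp_sub hϱ hH₁ hH₂ hγ hγR n 1

/-- Additive form. [folklore] -/
theorem curRem_add {H₁ H₂ : E → F} {R ϱ : ℝ} (hϱ : 0 < ϱ) (hH₁ : DifferentiableOn ℂ H₁ (ball 0 R))
    (hH₂ : DifferentiableOn ℂ H₂ (ball 0 R)) (n : ℕ) {γ : ℂ → E} (hγ : DifferentiableOn ℂ γ (ball 0 ϱ))
    (hγR : MapsTo γ (ball 0 ϱ) (ball 0 R)) : curRem (H₁ + H₂) n γ = curRem H₁ n γ + curRem H₂ n γ :=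
  taylorRem_comp_add hϱ hH₁ hH₂ hγ hγR n 1

/-- The curve-remainder family attached to the contour points is jointly continuous in `(t, s, σ)` when the slice-curve
family is (on the unit circle of the slice variable) and every curve is analytic on `|σ′| < ϱ` (ϱ > 1) into the
analyticity ball of `H` — `continuous_taylorRem_comp` at `P := ℂ × (ι → ℝ) × (ι → ℂ)`. [folklore] -/
theorem continuous_curRem_family {ι : Type*} {H : E → F} {R ϱ : ℝ} (hϱ : 1 < ϱ) (hH : DifferentiableOn ℂ H (ball 0 R))
    {Γ : ℂ → (ι → ℝ) → (ι → ℂ) → ℂ → E} (hΓa : ∀ t s σ, DifferentiableOn ℂ (Γ t s σ) (ball 0 ϱ))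
    (hΓR : ∀ t s σ, MapsTo (Γ t s σ) (ball 0 ϱ) (ball 0 R))
    (hΓc : ContinuousOn (fun q : (ℂ × (ι → ℝ) × (ι → ℂ)) × ℂ => Γ q.1.1 q.1.2.1 q.1.2.2 q.2)
      (univ ×ˢ sphere (0:ℂ) 1)) (n : ℕ) :
    Continuous fun p : ℂ × (ι → ℝ) × (ι → ℂ) => curRem H n (Γ p.1 p.2.1 p.2.2) :=
  continuous_taylorRem_comp (P := ℂ × (ι → ℝ) × (ι → ℂ)) hϱ hH (γ := fun p => Γ p.1 p.2.1 p.2.2)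
    (fun p => hΓa p.1 p.2.1 p.2.2) (fun p => hΓR p.1 p.2.1 p.2.2) hΓc n

variable {ι : Type*} [DecidableEq ι]

/-- **THE (1.23)-FUNCTIONAL OF THE CURVE REMAINDER IS SUBTRACTIVE IN THE OLD TERM** (the form `PieceAdditiveOn` asks): for
`ρ > 1` (print: e^{κ₁}), `r > 0`, `ϱ > 1`, old terms `H₁, H₂` analytic on the ball `‖z‖ < R`, and a slice-curve family
`Γ t s σ : ℂ → E` with every curve analytic on `|σ′| < ϱ` into that ball (Lemma 4 (3.53) TYPE, displayed) and JOINTLY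
CONTINUOUS in `(t, s, σ, σ′)` on the unit circle of the slice variable (displayed regularity — TYPE [II] (1.21)/(1.23) p. 7),
`curPiece ρ r l (H₁ − H₂) n Γ = curPiece ρ r l H₁ n Γ − curPiece ρ r l H₂ n Γ` — engine: `NE9RemainderPieceAdditive.cauchyOp_sub`
/ `continuous_cauchyOp` with the continuity of the remainder family DERIVED (`continuous_curRem_family`), so no
remainder-level continuity binder is displayed. [cite: Balaban1988RG2Cluster, (1.23) p.7] -/
theorem curPiece_sub {ρ r R ϱ : ℝ} (hρ : 1 < ρ) (hr : 0 < r) (hϱ : 1 < ϱ) {H₁ H₂ : E → F}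
    (hH₁ : DifferentiableOn ℂ H₁ (ball 0 R)) (hH₂ : DifferentiableOn ℂ H₂ (ball 0 R)) (l : List ι) (n : ℕ)
    {Γ : ℂ → (ι → ℝ) → (ι → ℂ) → ℂ → E} (hΓa : ∀ t s σ, DifferentiableOn ℂ (Γ t s σ) (ball 0 ϱ))
    (hΓR : ∀ t s σ, MapsTo (Γ t s σ) (ball 0 ϱ) (ball 0 R))
    (hΓc : ContinuousOn (fun q : (ℂ × (ι → ℝ) × (ι → ℂ)) × ℂ => Γ q.1.1 q.1.2.1 q.1.2.2 q.2)
      (univ ×ˢ sphere (0:ℂ) 1))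
    (s : ι → ℝ) (σ : ι → ℂ) :
    curPiece ρ r l (H₁ - H₂) n Γ s σ = curPiece ρ r l H₁ n Γ s σ - curPiece ρ r l H₂ n Γ s σ := by
  have hϱ0 : 0 < ϱ := zero_lt_one.trans hϱ
  unfold curPiece
  have hsplit : ∀ t : ℂ, (fun s' σ' => curRem (H₁ - H₂) n (Γ t s' σ')) =
      (fun s' σ' => curRem H₁ n (Γ t s' σ')) - fun s' σ' => curRem H₂ n (Γ t s' σ') := by
    intro t; funext s' σ'; simp only [Pi.sub_apply]
    exact curRem_sub hϱ0 hH₁ hH₂ n (hΓa t s' σ') (hΓR t s' σ')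
  have hC : ∀ {H : E → F}, DifferentiableOn ℂ H (ball 0 R) →
      Continuous fun p : ℂ × (ι → ℝ) × (ι → ℂ) => curRem H n (Γ p.1 p.2.1 p.2.2) :=
    fun hH => continuous_curRem_family hϱ hH hΓa hΓR hΓc n
  have hcont : ∀ {H : E → F}, DifferentiableOn ℂ H (ball 0 R) →
      Continuous fun t : ℂ => cauchyOp ρ l (fun s' σ' => curRem H n (Γ t s' σ')) s σ := by
    intro H hH
    have e : Continuous fun t : ℂ => (t, (s, σ)) :=
      continuous_id.prodMk (continuous_const : Continuous fun _ : ℂ => (s, σ))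
    exact (continuous_cauchyOp (X := ℂ) hρ l (h := fun t s' σ' => curRem H n (Γ t s' σ')) (hC hH)).comp e
  have hci : ∀ {H : E → F}, DifferentiableOn ℂ H (ball 0 R) →
      CircleIntegrable (fun t => (t ^ 2)⁻¹ • cauchyOp ρ l (fun s' σ' => curRem H n (Γ t s' σ')) s σ) 0 r := by
    intro H hH
    refine ContinuousOn.circleIntegrable hr.le (ContinuousOn.smul ?_ (hcont hH).continuousOn)
    refine ContinuousOn.inv₀ (by fun_prop) fun t ht => pow_ne_zero _ ?_
    intro h0
    have htn : ‖t‖ = r := by simpa using ht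
    rw [h0, norm_zero] at htn
    exact hr.ne' htn.symm
  have hpt : ∀ t : ℂ, cauchyOp ρ l (fun s' σ' => curRem (H₁ - H₂) n (Γ t s' σ')) s σ =
      cauchyOp ρ l (fun s' σ' => curRem H₁ n (Γ t s' σ')) s σ -
        cauchyOp ρ l (fun s' σ' => curRem H₂ n (Γ t s' σ')) s σ := by
    intro t
    rw [hsplit t]
    have e : Continuous fun q : (ι → ℝ) × (ι → ℂ) => (t, q) :=
      (continuous_const : Continuous fun _ : (ι → ℝ) × (ι → ℂ) => t).prodMk continuous_id
    exact cauchyOp_sub hρ l ((hC hH₁).comp e) ((hC hH₂).comp e) s σ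
  simp_rw [hpt, smul_sub]
  rw [circleIntegral.integral_sub (hci hH₁) (hci hH₂), smul_sub]


/-! ## §4 `PieceAdditiveOn` (S3) for the CURVE species on the analytic class — crew row (w19) -/

section Species

variable {C : Carriers} {Bg : Type} [NormedAddCommGroup Bg] [NormedSpace ℂ Bg] {ι₀ α β γ δ : Type} [DecidableEq δ]

/-- **`PieceAdditiveOn` FOR THE CURVE SPECIES ON THE ANALYTIC CLASS (crew row (w19); the point of the module)**: the
(1.23)-pieces of the owner's curve species `CurData.toC` — piece at (X, re/im) = Re/Im `curPiece e^{κ₁} r_k cubes (lift H X) 5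
cur s₀ σ₀` — are SUBTRACTIVE in the old term on `analyticClass D.R`, from `curPiece_sub` BY NAME, under `κ₁ > 0`, `r_k > 0`,
`ϱ > 1` and the SLICE-CURVE REGULARITY binders (displayed, instantiation-side — TYPE [I] Lemma 4 (3.53) p. 280 and [II]
(1.21)/(1.23) p. 7): `hcurA` — every slice curve is analytic on its disc `|σ′| < ϱ` and maps it into the analyticity ball of
its source (the `Admissible.cur_an` clause asked EVERYWHERE, not only on the contours — a harmless convention, the functional
reads the curves on the contours only); `hcurC` — the curve family is jointly continuous in `(t, s, σ, σ′)` on the unit circle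
of the slice variable.  NO remainder-level continuity is displayed: it is DERIVED (`continuous_curRem_family`).
[cite: Balaban1987RG1, (3.53) p.280; Balaban1988RG2Cluster, (1.23) p.7] -/
theorem pieceAdditiveOn_cur (D : CurData C Bg ι₀ α β γ δ) (hκ₁ : 0 < D.κ₁) (hr : ∀ k, 0 < D.r k)
    (hϱ : ∀ k s y a b x, 1 < D.ϱ k s y a b x)
    (hcurA : ∀ k s y a b x t s' σ', DifferentiableOn ℂ (D.cur k s y a b x t s' σ') (ball 0 (D.ϱ k s y a b x)) ∧
      MapsTo (D.cur k s y a b x t s' σ') (ball 0 (D.ϱ k s y a b x)) (ball 0 (D.R x.1)))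
    (hcurC : ∀ k s y a b x, ContinuousOn
      (fun q : (ℂ × (δ → ℝ) × (δ → ℂ)) × ℂ => D.cur k s y a b x q.1.1 q.1.2.1 q.1.2.2 q.2) (univ ×ˢ sphere (0:ℂ) 1)) :
    PieceAdditiveOn (analyticClass D.R) D.toC := by
  intro k s y a b x H₁ h₁ H₂ h₂
  show reIm x.2 (curPiece (Real.exp D.κ₁) (D.r k) (D.cubes k y a b) (lift (H₁ - H₂) x.1) 5 (D.cur k s y a b x)
      (fun _ => (0:ℝ)) (fun _ => ((Real.exp D.κ₁ : ℝ) : ℂ))) =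
    reIm x.2 (curPiece (Real.exp D.κ₁) (D.r k) (D.cubes k y a b) (lift H₁ x.1) 5 (D.cur k s y a b x)
      (fun _ => (0:ℝ)) (fun _ => ((Real.exp D.κ₁ : ℝ) : ℂ))) -
    reIm x.2 (curPiece (Real.exp D.κ₁) (D.r k) (D.cubes k y a b) (lift H₂ x.1) 5 (D.cur k s y a b x)
      (fun _ => (0:ℝ)) (fun _ => ((Real.exp D.κ₁ : ℝ) : ℂ)))
  rw [lift_sub, curPiece_sub (one_lt_exp_of_pos hκ₁) (hr k) (hϱ k s y a b x) (h₁ x.1) (h₂ x.1) (D.cubes k y a b) 5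
    (fun t s' σ' => (hcurA k s y a b x t s' σ').1) (fun t s' σ' => (hcurA k s y a b x t s' σ').2) (hcurC k s y a b x),
    reIm_sub]

/-- **S3 FOR THE CURVE SPECIES**: `ChannelAdditive (analyticClass D.R) (cpieceChannel D.toC)` — the owner's
`channelAdditive_cur_of_pieceAdditive` fed with `pieceAdditiveOn_cur`. [folklore] -/
theorem channelAdditive_cur (D : CurData C Bg ι₀ α β γ δ) (hκ₁ : 0 < D.κ₁) (hr : ∀ k, 0 < D.r k)
    (hϱ : ∀ k s y a b x, 1 < D.ϱ k s y a b x)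
    (hcurA : ∀ k s y a b x t s' σ', DifferentiableOn ℂ (D.cur k s y a b x t s' σ') (ball 0 (D.ϱ k s y a b x)) ∧
      MapsTo (D.cur k s y a b x t s' σ') (ball 0 (D.ϱ k s y a b x)) (ball 0 (D.R x.1)))
    (hcurC : ∀ k s y a b x, ContinuousOn
      (fun q : (ℂ × (δ → ℝ) × (δ → ℂ)) × ℂ => D.cur k s y a b x q.1.1 q.1.2.1 q.1.2.2 q.2) (univ ×ˢ sphere (0:ℂ) 1)) :
    ChannelAdditive (analyticClass D.R) (cpieceChannel D.toC) :=
  channelAdditive_cur_of_pieceAdditive (pieceAdditiveOn_cur D hκ₁ hr hϱ hcurA hcurC)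

/-- **ALL FOUR S-BINDERS OF THE NE9 END FOR THE CURVE SPECIES ON THE ANALYTIC CLASS** (S3 — this file; S4 `ChannelLocal` /
`ChannelStepSum` and S5 `ChannelSizeAtStepNN` — the owner's part 2 BY NAME): under `CurData.Admissible` (printed TYPE: Lemma 4
domain inclusion ON THE CONTOURS, gain ϱ⁻¹ ≤ c_dir·ℓ, radii, G1), the level counts, and the slice-curve regularity binders
`hcurA` (the analytic/MapsTo clause everywhere), `hcurC` (joint continuity on the unit slice circle) — i.e. KERNEL modulo O1,
printed-TYPE binders and curve regularity. [folklore] -/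
theorem sBinders_cur {D : CurData C Bg ι₀ α β γ δ} {ℓ ℓ' : ℕ → ℕ → ℝ} {cdir d0 O1 cQ : ℝ}
    (hD : D.Admissible ℓ cdir d0) (hℓ : ∀ k j, 0 ≤ ℓ k j) (κ : ℝ)
    (hL : LevelCountsG D.toC.frame κ D.κ₁ O1 cQ (fun k j => ℓ k j ^ 5) ℓ') (hO1 : 0 ≤ O1)
    (hcQℓ : ∀ k j, 0 ≤ cQ * ℓ' k j)
    (hcurA : ∀ k s y a b x t s' σ', DifferentiableOn ℂ (D.cur k s y a b x t s' σ') (ball 0 (D.ϱ k s y a b x)) ∧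
      MapsTo (D.cur k s y a b x t s' σ') (ball 0 (D.ϱ k s y a b x)) (ball 0 (D.R x.1)))
    (hcurC : ∀ k s y a b x, ContinuousOn
      (fun q : (ℂ × (δ → ℝ) × (δ → ℂ)) × ℂ => D.cur k s y a b x q.1.1 q.1.2.1 q.1.2.2 q.2) (univ ×ˢ sphere (0:ℂ) 1)) :
    ChannelAdditive (analyticClass D.R) (cpieceChannel D.toC) ∧
      ChannelLocal (analyticClass D.R) (cpieceChannel D.toC) ∧
      ChannelStepSum (analyticClass D.R) (cpieceChannel D.toC) ∧
      ChannelSizeAtStepNN (analyticClass D.R) (cpieceChannel D.toC) κ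
        (weightOf D.toC.frame D.κ₁ d0 O1 (D.Kp cdir)) (tauOfG cQ ℓ') :=
  have hκ₁ : 0 < D.κ₁ := lt_of_lt_of_le one_pos hD.κ₁_ge
  ⟨channelAdditive_cur D hκ₁ hD.r_pos hD.ϱ_gt hcurA hcurC, (structureBinders_cur hD _).1, (structureBinders_cur hD _).2.1,
    channelSizeAtStepNN_cur hD hℓ κ hL hO1 hcQℓ⟩

end Species

end Summit.QuantumFields.BalabanUV.T4Continuum.NE9Lemma1CurveSpeciesAdditive
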